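import Literature.Combinatorics.Optimization.ShellLawEdgeProduct
import HarnessLib

/-!
# The weighted edge product and the universal TYPE STEP for multi-block shell statistics

Continuation of `ShellLawEdgeProduct.lean` (cell `pnp-psdrank`, lit g32).  There the vertices carried the
weight `X^{[v ∈ H]}` of ONE block `H`.  Here every vertex `v` carries an arbitrary weight `ω v` in a
commutative ring `R` (for two disjoint blocks: `ω v = X₁^{[v∈H₁]}·X₂^{[v∈H₂]}`, for `k` blocks a monomial in
`k` variables), and the same one-edge-at-a-time induction gives the WEIGHTED EDGE PRODUCT

  `Ψ^ω_S(Y,Z) := Σ_{U ⊆ S} (Π_{v∈U} ω v)·Y^{|full U|}·Z^{|half U|} = Π_{edges {v,πv} ⊆ S} F(ω v, ω πv)`,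
  `F(u,v) = 1 + Z·(u + v) + Y²·u·v`

(an edge is untouched, half-matched at either end, or full).  The point of the generality is the
**universal swap identity** `F(u,v)·F(u′,v′) − F(u,v′)·F(u′,v) = (Y² − Z²)·(u − u′)·(v − v′)`: exchanging the
partners of two edges changes `Ψ^ω` by `(Y² − Z²)(ω p − ω q)(ω πp − ω πq)·Ψ^ω_{S∖e_p∖e_q}` — the TYPE STEP for
every multi-block statistic at once (one block: `(1−X)²`, eng g20's `typeStep_shellCount` / lit's
`shellGen_typeStep`; two blocks: `(X₁−X₂)²`, `(1−X₁)²`, `(1−X₁)(1−X₂)` — MIXED second differences,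
LIT-44 §1.4(i), eng g21's two-block class CG2SYM).

* §1 `wShellGF_insert_insert`, `wShellGF_close_eq_prod`, **`wShellGF_eq_prod`** — the weighted edge product.
* §2 **`edgeFactor_swap`** — the universal swap identity (pure ring algebra).
* §3 `coeff_coeff_wShellGF` — `[Z^c][Y^f] Ψ^ω_S = Σ_{U ∈ Shell_S(f+c,c)} Π_{v∈U} ω v`; `wShellGF_congr`.
* §4 **`wShellGF_typeStep`**, **`wShellGen_typeStep`** — the TYPE STEP for weights, on ONE ground set with two
  weight functions differing by the swap of the values at `πp` and `πq`: generating-function form and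
  shell (coefficient) form.
* §5 two blocks: `prod_blockWeight₂` (`Π_{v∈U} X₁^{[v∈H₁]}X₂^{[v∈H₂]} = X₁^{|U∩H₁|}·X₂^{|U∩H₂|}`, so
  `wShellGF_eq_prod`/`wShellGen_typeStep` with this weight in `R = ℝ[X₁][X₂]` are the two-block edge product
  and type step; for disjoint blocks the edge factors take the six values `1+2ZX_i+Y²X_i²` (`H_iH_i`),
  `1+ZX₁+ZX₂+Y²X₁X₂` (`H₁H₂`), `1+Z+ZX_i+Y²X_i` (`H_i∅`), `1+2Z+Y²` (`∅∅`)) and `coeff_coeff_wShellGen₂`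
  (the joint shell count `#{U ∈ Shell_S(t,c) : |U∩H₁| = x₁, |U∩H₂| = x₂}` as a coefficient).

All statements are bookkeeping identities on Rothvoß's slack-matrix combinatorics of cuts versus ONE
perfect matching [Rothvoß 2017, §2]; everything is proved, no definitions, no named facts.

## References

* [Rothvoss2017] T. Rothvoß, *The matching polytope has exponential extension complexity*, J. ACM 64
  (2017), §2 (PDF pp. 5–6).
* [GodsilMeagher2015] C. Godsil, K. Meagher, *Erdős–Ko–Rado Theorems: Algebraic Approaches*, CUP 2015,
  §15.2.
-/

noncomputable section

open Finset Polynomial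

namespace Literature.Combinatorics.Optimization

namespace ShellStep

variable {n : ℕ} {π : Fin n → Fin n} {R : Type*} [CommRing R]

section Weighted

variable (hπ : ∀ v, π (π v) = v) (hπ' : ∀ v, π v ≠ v)
include hπ hπ'

/-! ### §1 The weighted edge product -/

/-- **One more edge, weighted.** Adding the edge `{v, πv}` to a ground set `S₀` multiplies
`Σ_{U ⊆ S₀} (Π_U ω)·Y^{|full U|}·Z^{|half U|}` by `1 + Z·ω(πv) + Z·ω(v) + Y²·ω(v)ω(πv)`.
[cite: Rothvoss2017, §2 (PDF p. 5)] -/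
theorem wShellGF_insert_insert {S₀ : Finset (Fin n)} (ω : Fin n → R) {v : Fin n} (hv : v ∉ S₀)
    (hπv : π v ∉ S₀) :
    ∑ U ∈ (insert v (insert (π v) S₀)).powerset,
        C (C (∏ u ∈ U, ω u) * (X : Polynomial R) ^ (full π U).card) *
          (X : Polynomial (Polynomial R)) ^ (half π U).card =
      (∑ U ∈ S₀.powerset,
        C (C (∏ u ∈ U, ω u) * (X : Polynomial R) ^ (full π U).card) *
          (X : Polynomial (Polynomial R)) ^ (half π U).card) *
      (1 + X * C (C (ω (π v))) + X * C (C (ω v)) + C ((X : Polynomial R) ^ 2 * C (ω v * ω (π v)))) := by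
  classical
  have hvπ : v ≠ π v := fun h => hπ' v h.symm
  have hv' : v ∉ insert (π v) S₀ := by rw [mem_insert]; exact fun h => h.elim (fun h => hvπ h) hv
  have hA : ∑ U ∈ S₀.powerset,
      C (C (∏ u ∈ insert (π v) U, ω u) * (X : Polynomial R) ^ (full π (insert (π v) U)).card) *
        (X : Polynomial (Polynomial R)) ^ (half π (insert (π v) U)).card =
      (∑ U ∈ S₀.powerset,
        C (C (∏ u ∈ U, ω u) * (X : Polynomial R) ^ (full π U).card) *
          (X : Polynomial (Polynomial R)) ^ (half π U).card) * (X * C (C (ω (π v)))) := by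
    rw [sum_mul]
    refine sum_congr rfl fun U hU => ?_
    have hUS : U ⊆ S₀ := mem_powerset.1 hU
    have h1 : π v ∉ U := fun h => hπv (hUS h)
    have h2 : π (π v) ∉ U := by rw [hπ]; exact fun h => hv (hUS h)
    rw [half_insert_of_notMem hπ hπ' h1 h2, full_insert_of_notMem hπ hπ' h1 h2,
      card_insert_of_notMem (fun h => h1 (mem_half.1 h).1), prod_insert h1, pow_succ]
    simp only [map_mul]
    ring
  have hB : ∑ U ∈ S₀.powerset,
      C (C (∏ u ∈ insert v U, ω u) * (X : Polynomial R) ^ (full π (insert v U)).card) *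
        (X : Polynomial (Polynomial R)) ^ (half π (insert v U)).card =
      (∑ U ∈ S₀.powerset,
        C (C (∏ u ∈ U, ω u) * (X : Polynomial R) ^ (full π U).card) *
          (X : Polynomial (Polynomial R)) ^ (half π U).card) * (X * C (C (ω v))) := by
    rw [sum_mul]
    refine sum_congr rfl fun U hU => ?_
    have hUS : U ⊆ S₀ := mem_powerset.1 hU
    have h1 : v ∉ U := fun h => hv (hUS h)
    have h2 : π v ∉ U := fun h => hπv (hUS h)
    rw [half_insert_of_notMem hπ hπ' h1 h2, full_insert_of_notMem hπ hπ' h1 h2,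
      card_insert_of_notMem (fun h => h1 (mem_half.1 h).1), prod_insert h1, pow_succ]
    simp only [map_mul]
    ring
  have hC : ∑ U ∈ S₀.powerset,
      C (C (∏ u ∈ insert v (insert (π v) U), ω u) *
          (X : Polynomial R) ^ (full π (insert v (insert (π v) U))).card) *
        (X : Polynomial (Polynomial R)) ^ (half π (insert v (insert (π v) U))).card =
      (∑ U ∈ S₀.powerset,
        C (C (∏ u ∈ U, ω u) * (X : Polynomial R) ^ (full π U).card) *
          (X : Polynomial (Polynomial R)) ^ (half π U).card) *
      C ((X : Polynomial R) ^ 2 * C (ω v * ω (π v))) := by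
    rw [sum_mul]
    refine sum_congr rfl fun U hU => ?_
    have hUS : U ⊆ S₀ := mem_powerset.1 hU
    have h1 : v ∉ U := fun h => hv (hUS h)
    have h2 : π v ∉ U := fun h => hπv (hUS h)
    have h3 : v ∉ insert (π v) U := by rw [mem_insert]; exact fun h => h.elim (fun h => hvπ h) h1
    rw [half_insert_insert_of_notMem hπ h1 h2, full_insert_insert_of_notMem hπ h1 h2,
      card_insert_of_notMem (by rw [mem_insert, mem_full]; exact fun h => h.elim (fun h => hvπ h) fun h => h1 h.1),
      card_insert_of_notMem (fun h => h2 (mem_full.1 h).1), prod_insert h3, prod_insert h2,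
      pow_add, pow_succ, pow_succ]
    simp only [map_mul, map_pow]
    ring
  rw [sum_powerset_insert hv', sum_powerset_insert hπv, sum_powerset_insert hπv, hA, hB, hC]
  ring

/-- **The weighted edge product over representatives**: for representatives `T` (`v < πv`) of a set of
edges, `Σ_{U ⊆ T ∪ πT} (Π_U ω) Y^{|full U|} Z^{|half U|} = Π_{v ∈ T} (1 + Zω(πv) + Zω(v) + Y²ω(v)ω(πv))`.
[cite: Rothvoss2017, §2 (PDF p. 5)] [cite: GodsilMeagher2015, §15.2] -/
theorem wShellGF_close_eq_prod (ω : Fin n → R) {T : Finset (Fin n)} (hT : ∀ v ∈ T, v < π v) :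
    ∑ U ∈ (close π T).powerset,
        C (C (∏ u ∈ U, ω u) * (X : Polynomial R) ^ (full π U).card) *
          (X : Polynomial (Polynomial R)) ^ (half π U).card =
      ∏ v ∈ T, (1 + X * C (C (ω (π v))) + X * C (C (ω v)) + C ((X : Polynomial R) ^ 2 * C (ω v * ω (π v)))) := by
  classical
  induction T using Finset.induction_on with
  | empty =>
    rw [prod_empty]
    have : close π (∅ : Finset (Fin n)) = ∅ := by
      ext v; rw [mem_close hπ]; simp
    rw [this, powerset_empty, sum_singleton]
    simp [half, full]
  | insert v T hvT ih =>
    have hT' : ∀ w ∈ T, w < π w := fun w hw => hT w (mem_insert_of_mem hw)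
    have hvlt : v < π v := hT v (mem_insert_self v T)
    have hv : v ∉ close π T := by
      rw [mem_close hπ]
      rintro (h | h)
      · exact hvT h
      · have := hT' _ h; rw [hπ] at this; exact absurd (hvlt.trans this) (lt_irrefl _)
    have hπv : π v ∉ close π T := by
      rw [mem_close hπ, hπ]
      rintro (h | h)
      · have := hT' _ h; rw [hπ] at this; exact absurd (hvlt.trans this) (lt_irrefl _)
      · exact hvT h
    have hclose : close π (insert v T) = insert v (insert (π v) (close π T)) := by
      ext u; simp only [mem_close hπ, mem_insert]
      constructor
      · rintro ((rfl | hu) | (h | hu))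
        · exact Or.inl rfl
        · exact Or.inr (Or.inr (Or.inl hu))
        · exact Or.inr (Or.inl (by rw [← h, hπ]))
        · exact Or.inr (Or.inr (Or.inr hu))
      · rintro (rfl | rfl | (hu | hu))
        · exact Or.inl (Or.inl rfl)
        · exact Or.inr (Or.inl (by rw [hπ]))
        · exact Or.inl (Or.inr hu)
        · exact Or.inr (Or.inr hu)
    rw [hclose, wShellGF_insert_insert hπ hπ' ω hv hπv, ih hT', prod_insert hvT]
    ring

/-- **The weighted edge product**: for a `π`-stable ground set `S` and any vertex weights `ω`,
`Σ_{U ⊆ S} (Π_{v∈U} ω v)·Y^{|full U|}·Z^{|half U|} = Π_{v ∈ reps S} (1 + Z·ω(πv) + Z·ω(v) + Y²·ω(v)ω(πv))`.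
[cite: Rothvoss2017, §2 (PDF p. 5)] [cite: GodsilMeagher2015, §15.2] -/
theorem wShellGF_eq_prod {S : Finset (Fin n)} (hS : ∀ v ∈ S, π v ∈ S) (ω : Fin n → R) :
    ∑ U ∈ S.powerset,
        C (C (∏ u ∈ U, ω u) * (X : Polynomial R) ^ (full π U).card) *
          (X : Polynomial (Polynomial R)) ^ (half π U).card =
      ∏ v ∈ reps π S, (1 + X * C (C (ω (π v))) + X * C (C (ω v)) + C ((X : Polynomial R) ^ 2 * C (ω v * ω (π v)))) := by
  conv_lhs => rw [← close_reps hπ hπ' hS]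
  exact wShellGF_close_eq_prod hπ hπ' ω fun v hv => (mem_reps.1 hv).2

/-! ### §2 The universal swap identity -/

omit hπ hπ' in
/-- **The universal swap identity**: with `F(u,v) = 1 + Z·v + Z·u + Y²·u·v`,
`F(u,v)·F(u′,v′) − F(u,v′)·F(u′,v) = (Y² − Z²)·(u − u′)·(v − v′)`.
(The linear, `ZY²` and `Y⁴` terms cancel; `Y²(uv + u′v′ − uv′ − u′v) = Y²(u−u′)(v−v′)` and
`Z²((u+v)(u′+v′) − (u+v′)(u′+v)) = −Z²(u−u′)(v−v′)`.) [cite: Rothvoss2017, §2 (PDF p. 6)] -/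
theorem edgeFactor_swap (u v u' v' : R) :
    (1 + X * C (C v) + X * C (C u) + C ((X : Polynomial R) ^ 2 * C (u * v))) *
        (1 + X * C (C v') + X * C (C u') + C ((X : Polynomial R) ^ 2 * C (u' * v'))) -
      (1 + X * C (C v') + X * C (C u) + C ((X : Polynomial R) ^ 2 * C (u * v'))) *
        (1 + X * C (C v) + X * C (C u') + C ((X : Polynomial R) ^ 2 * C (u' * v))) =
      (C ((X : Polynomial R) ^ 2) - (X : Polynomial (Polynomial R)) ^ 2) *
        C (C ((u - u') * (v - v'))) := by
  simp only [map_mul, map_pow, map_sub]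
  ring

/-! ### §3 Coefficient extraction and congruence -/

omit hπ hπ' in
/-- **Coefficient extraction**: `[Z^c][Y^f] Ψ^ω_S = Σ_{U ∈ Shell_S(f+c,c)} Π_{v∈U} ω v`.
[cite: Rothvoss2017, §2 (PDF p. 6)] -/
theorem coeff_coeff_wShellGF (S : Finset (Fin n)) (ω : Fin n → R) (c f : ℕ) :
    ((∑ U ∈ S.powerset,
        C (C (∏ u ∈ U, ω u) * (X : Polynomial R) ^ (full π U).card) *
          (X : Polynomial (Polynomial R)) ^ (half π U).card).coeff c).coeff f =
      ∑ U ∈ shellIn π S (f + c) c, ∏ u ∈ U, ω u := by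
  rw [finsetSum_coeff, finsetSum_coeff]
  simp only [coeff_C_mul_X_pow]
  rw [shellIn, sum_filter]
  refine sum_congr rfl fun U _ => ?_
  have hfh := card_full_add_card_half (π := π) U
  by_cases hc : c = (half π U).card
  · rw [if_pos hc, coeff_C_mul_X_pow]
    by_cases hf : f = (full π U).card
    · rw [if_pos hf, if_pos ⟨by omega, hc.symm⟩]
    · rw [if_neg hf, if_neg (by omega)]
  · rw [if_neg hc, coeff_zero, if_neg (fun h => hc h.2.symm)]

omit hπ hπ' in
/-- Weights that agree on `S` give the same weighted sums over `S`. [cite: Rothvoss2017, §2 (PDF p. 6)] -/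
theorem wShellGF_congr {S : Finset (Fin n)} {ω₁ ω₂ : Fin n → R} (h : ∀ u ∈ S, ω₁ u = ω₂ u) :
    ∑ U ∈ S.powerset,
        C (C (∏ u ∈ U, ω₁ u) * (X : Polynomial R) ^ (full π U).card) *
          (X : Polynomial (Polynomial R)) ^ (half π U).card =
      ∑ U ∈ S.powerset,
        C (C (∏ u ∈ U, ω₂ u) * (X : Polynomial R) ^ (full π U).card) *
          (X : Polynomial (Polynomial R)) ^ (half π U).card := by
  refine sum_congr rfl fun U hU => ?_
  rw [prod_congr rfl fun u hu => h u (mem_powerset.1 hU hu)]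

/-! ### §4 The TYPE STEP for weights -/

omit hπ hπ' in
/-- Re-inserting a deleted edge. [cite: Rothvoss2017, §2 (PDF p. 5)] -/
theorem insert_insert_sdiff_pair {S : Finset (Fin n)} {v : Fin n} (hv : v ∈ S) (hπv : π v ∈ S) :
    insert v (insert (π v) (S \ {v, π v})) = S := by
  ext u
  simp only [mem_insert, mem_sdiff, mem_singleton, not_or]
  constructor
  · rintro (rfl | rfl | ⟨hu, _⟩)
    · exact hv
    · exact hπv
    · exact hu
  · intro hu
    by_cases h1 : u = v
    · exact Or.inl h1
    · by_cases h2 : u = π v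
      · exact Or.inr (Or.inl h2)
      · exact Or.inr (Or.inr ⟨hu, h1, h2⟩)

/-- The weighted edge product factors off one edge: `Ψ^ω_S = Ψ^ω_{S∖e_v}·F(ω v, ω πv)`.
[cite: Rothvoss2017, §2 (PDF p. 5)] -/
theorem wShellGF_eq_sdiff_pair_mul {S : Finset (Fin n)} (hS : ∀ v ∈ S, π v ∈ S) (ω : Fin n → R)
    {v : Fin n} (hv : v ∈ S) :
    ∑ U ∈ S.powerset,
        C (C (∏ u ∈ U, ω u) * (X : Polynomial R) ^ (full π U).card) *
          (X : Polynomial (Polynomial R)) ^ (half π U).card =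
      (∑ U ∈ (S \ {v, π v}).powerset,
        C (C (∏ u ∈ U, ω u) * (X : Polynomial R) ^ (full π U).card) *
          (X : Polynomial (Polynomial R)) ^ (half π U).card) *
      (1 + X * C (C (ω (π v))) + X * C (C (ω v)) + C ((X : Polynomial R) ^ 2 * C (ω v * ω (π v)))) := by
  have hv' : v ∉ S \ {v, π v} := by simp
  have hπv' : π v ∉ S \ {v, π v} := by simp
  rw [← wShellGF_insert_insert hπ hπ' ω hv' hπv', insert_insert_sdiff_pair hv (hS v hv)]

/-- **The TYPE STEP for weights (generating functions).** On ONE `π`-stable ground set `S` with two edges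
`e_p ≠ e_q`, let `ω₂` be `ω₁` with the values at `πp` and `πq` exchanged (so the edge `{p,πp}` carries
`(ω₁ p, ω₁ πq)` and `{q,πq}` carries `(ω₁ q, ω₁ πp)`: the partners are swapped). Then
`Ψ^{ω₁}_S − Ψ^{ω₂}_S = Ψ^{ω₁}_{S∖e_p∖e_q} · (Y² − Z²)·(ω₁ p − ω₁ q)(ω₁ πp − ω₁ πq)`.
[cite: Rothvoss2017, §2 (PDF p. 6)] -/
theorem wShellGF_typeStep {S : Finset (Fin n)} (hS : ∀ v ∈ S, π v ∈ S) (ω₁ : Fin n → R)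
    {p q : Fin n} (hp : p ∈ S) (hq : q ∈ S) (hqp : q ≠ p) (hqπ : q ≠ π p) :
    (∑ U ∈ S.powerset,
        C (C (∏ u ∈ U, ω₁ u) * (X : Polynomial R) ^ (full π U).card) *
          (X : Polynomial (Polynomial R)) ^ (half π U).card) -
      (∑ U ∈ S.powerset,
        C (C (∏ u ∈ U, Function.update (Function.update ω₁ (π p) (ω₁ (π q))) (π q) (ω₁ (π p)) u) *
            (X : Polynomial R) ^ (full π U).card) *
          (X : Polynomial (Polynomial R)) ^ (half π U).card) =
      (∑ U ∈ (del2 π S p q).powerset,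
        C (C (∏ u ∈ U, ω₁ u) * (X : Polynomial R) ^ (full π U).card) *
          (X : Polynomial (Polynomial R)) ^ (half π U).card) *
      ((C ((X : Polynomial R) ^ 2) - (X : Polynomial (Polynomial R)) ^ 2) *
        C (C ((ω₁ p - ω₁ q) * (ω₁ (π p) - ω₁ (π q))))) := by
  set ω₂ : Fin n → R := Function.update (Function.update ω₁ (π p) (ω₁ (π q))) (π q) (ω₁ (π p)) with hω₂
  -- the four vertices are distinct
  have hpπp : p ≠ π p := fun h => hπ' p h.symm
  have hqπq : q ≠ π q := fun h => hπ' q h.symm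
  have hπqπp : π q ≠ π p := fun h => hqp (π_injective hπ h)
  have hπqp : π q ≠ p := fun h => hqπ ((π_eq_iff hπ).1 h)
  have hpπq : p ≠ π q := fun h => hπqp h.symm
  -- values of ω₂
  have e_p : ω₂ p = ω₁ p := by
    rw [hω₂, Function.update_of_ne hpπq, Function.update_of_ne hpπp]
  have e_q : ω₂ q = ω₁ q := by
    rw [hω₂, Function.update_of_ne hqπq, Function.update_of_ne hqπ]
  have e_πp : ω₂ (π p) = ω₁ (π q) := by
    rw [hω₂, Function.update_of_ne hπqπp.symm, Function.update_self]
  have e_πq : ω₂ (π q) = ω₁ (π p) := by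
    rw [hω₂, Function.update_self]
  have e_0 : ∀ u ∈ del2 π S p q, ω₁ u = ω₂ u := by
    intro u hu
    obtain ⟨_, _, hup, _, huq⟩ := mem_del2.1 hu
    rw [hω₂, Function.update_of_ne huq, Function.update_of_ne hup]
  -- factor both products off the two edges
  have hS' := sdiff_pair_stable hπ hS p
  have hq' : q ∈ S \ {p, π p} := by
    rw [mem_sdiff, mem_insert, mem_singleton, not_or]; exact ⟨hq, hqp, hqπ⟩
  have f1 : ∀ ω : Fin n → R, ∑ U ∈ S.powerset,
        C (C (∏ u ∈ U, ω u) * (X : Polynomial R) ^ (full π U).card) *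
          (X : Polynomial (Polynomial R)) ^ (half π U).card =
      (∑ U ∈ (del2 π S p q).powerset,
        C (C (∏ u ∈ U, ω u) * (X : Polynomial R) ^ (full π U).card) *
          (X : Polynomial (Polynomial R)) ^ (half π U).card) *
      (1 + X * C (C (ω (π q))) + X * C (C (ω q)) + C ((X : Polynomial R) ^ 2 * C (ω q * ω (π q)))) *
      (1 + X * C (C (ω (π p))) + X * C (C (ω p)) + C ((X : Polynomial R) ^ 2 * C (ω p * ω (π p)))) := by
    intro ω
    rw [wShellGF_eq_sdiff_pair_mul hπ hπ' hS ω hp, wShellGF_eq_sdiff_pair_mul hπ hπ' hS' ω hq',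
      del2_eq_sdiff_sdiff]
  rw [f1 ω₁, f1 ω₂, ← wShellGF_congr e_0, e_p, e_q, e_πp, e_πq, mul_assoc, mul_assoc, ← mul_sub,
    ← edgeFactor_swap (ω₁ p) (ω₁ (π p)) (ω₁ q) (ω₁ (π q))]
  ring

/-- **The TYPE STEP for weights (shell form).** With `ω₂` = `ω₁` with the values at `πp`, `πq` exchanged
and `S₀ = S ∖ e_p ∖ e_q`, for every `c, f`:
`Σ_{U∈Shell_S(f+c,c)} Π_U ω₁ − Σ_{U∈Shell_S(f+c,c)} Π_U ω₂
   = (ω₁ p − ω₁ q)(ω₁ πp − ω₁ πq)·([2 ≤ f]·Σ_{Shell_{S₀}(f−2+c,c)} Π ω₁ − [2 ≤ c]·Σ_{Shell_{S₀}(f+c−2,c−2)} Π ω₁)`.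
For one block (`ω = X^{[·∈H]}`) the factor is `(1−X)²` or `0`; for two blocks it is one of `(1−X₁)²`,
`(1−X₂)²`, `(X₁−X₂)²`, `±(1−X₁)(1−X₂)`, `±(1−X_i)(X_1−X_2)`… — mixed second differences.
[cite: Rothvoss2017, §2 (PDF p. 6)] -/
theorem wShellGen_typeStep {S : Finset (Fin n)} (hS : ∀ v ∈ S, π v ∈ S) (ω₁ : Fin n → R)
    {p q : Fin n} (hp : p ∈ S) (hq : q ∈ S) (hqp : q ≠ p) (hqπ : q ≠ π p) (c f : ℕ) :
    (∑ U ∈ shellIn π S (f + c) c, ∏ u ∈ U, ω₁ u) -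
      (∑ U ∈ shellIn π S (f + c) c,
        ∏ u ∈ U, Function.update (Function.update ω₁ (π p) (ω₁ (π q))) (π q) (ω₁ (π p)) u) =
      (ω₁ p - ω₁ q) * (ω₁ (π p) - ω₁ (π q)) *
        ((if 2 ≤ f then ∑ U ∈ shellIn π (del2 π S p q) (f - 2 + c) c, ∏ u ∈ U, ω₁ u else 0) -
          (if 2 ≤ c then ∑ U ∈ shellIn π (del2 π S p q) (f + (c - 2)) (c - 2), ∏ u ∈ U, ω₁ u else 0)) := by
  have h := wShellGF_typeStep hπ hπ' hS ω₁ hp hq hqp hqπ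
  have hcf := congrArg (fun P : Polynomial (Polynomial R) => (P.coeff c).coeff f) h
  simp only [coeff_sub] at hcf
  rw [coeff_coeff_wShellGF, coeff_coeff_wShellGF] at hcf
  rw [hcf]
  set Ψ₀ := ∑ U ∈ (del2 π S p q).powerset,
        C (C (∏ u ∈ U, ω₁ u) * (X : Polynomial R) ^ (full π U).card) *
          (X : Polynomial (Polynomial R)) ^ (half π U).card with hΨ₀
  set r : R := (ω₁ p - ω₁ q) * (ω₁ (π p) - ω₁ (π q)) with hr
  have key : Ψ₀ * ((C ((X : Polynomial R) ^ 2) - (X : Polynomial (Polynomial R)) ^ 2) * C (C r)) =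
      Ψ₀ * (C ((X : Polynomial R) ^ 2) * C (C r)) - Ψ₀ * C (C r) * X ^ 2 := by ring
  rw [key, coeff_sub, coeff_sub]
  have e1 : ((Ψ₀ * (C ((X : Polynomial R) ^ 2) * C (C r))).coeff c).coeff f =
      if 2 ≤ f then r * ∑ U ∈ shellIn π (del2 π S p q) (f - 2 + c) c, ∏ u ∈ U, ω₁ u else 0 := by
    rw [← map_mul, coeff_mul_C, show (X : Polynomial R) ^ 2 * C r = C r * X ^ 2 by rw [mul_comm],
      ← mul_assoc, coeff_mul_X_pow', coeff_mul_C]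
    split_ifs with hf
    · rw [hΨ₀, coeff_coeff_wShellGF, mul_comm]
    · rfl
  have e2 : ((Ψ₀ * C (C r) * X ^ 2).coeff c).coeff f =
      if 2 ≤ c then r * ∑ U ∈ shellIn π (del2 π S p q) (f + (c - 2)) (c - 2), ∏ u ∈ U, ω₁ u else 0 := by
    rw [coeff_mul_X_pow']
    split_ifs with hc
    · rw [coeff_mul_C, coeff_mul_C, hΨ₀, coeff_coeff_wShellGF, mul_comm]
    · rw [coeff_zero]
  rw [e1, e2]
  split_ifs <;> ring

/-! ### §5 Two blocks -/

omit hπ hπ' in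
/-- The two-block weight: `Π_{v∈U} X₁^{[v∈H₁]}·X₂^{[v∈H₂]} = X₁^{|U∩H₁|}·X₂^{|U∩H₂|}` (here `X₁ = C X` is
the inner and `X₂ = X` the outer variable of `ℝ[X₁][X₂]`). [cite: Rothvoss2017, §2 (PDF p. 5)] -/
theorem prod_blockWeight₂ (H₁ H₂ U : Finset (Fin n)) :
    ∏ u ∈ U, (C ((X : Polynomial ℝ) ^ (if u ∈ H₁ then 1 else 0)) *
        (X : Polynomial (Polynomial ℝ)) ^ (if u ∈ H₂ then 1 else 0)) =
      C ((X : Polynomial ℝ) ^ (U ∩ H₁).card) * (X : Polynomial (Polynomial ℝ)) ^ (U ∩ H₂).card := by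
  rw [prod_mul_distrib, ← map_prod, prod_pow_eq_pow_sum, prod_pow_eq_pow_sum, sum_boole, sum_boole,
    filter_mem_eq_inter, filter_mem_eq_inter]
  simp

omit hπ hπ' in
/-- **The joint two-block shell count as a coefficient**: the `X₁^{x₁} X₂^{x₂}` coefficient of
`Σ_{U ∈ Shell_S(t,c)} X₁^{|U∩H₁|} X₂^{|U∩H₂|}` is `#{U ∈ Shell_S(t,c) : |U∩H₁| = x₁, |U∩H₂| = x₂}`.
[cite: Rothvoss2017, §2 (PDF p. 6)] -/
theorem coeff_coeff_wShellGen₂ (S H₁ H₂ : Finset (Fin n)) (t c x₁ x₂ : ℕ) :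
    ((∑ U ∈ shellIn π S t c,
        C ((X : Polynomial ℝ) ^ (U ∩ H₁).card) * (X : Polynomial (Polynomial ℝ)) ^ (U ∩ H₂).card).coeff x₂).coeff x₁ =
      (((shellIn π S t c).filter fun U => (U ∩ H₁).card = x₁ ∧ (U ∩ H₂).card = x₂).card : ℝ) := by
  rw [finsetSum_coeff, finsetSum_coeff, card_filter, Nat.cast_sum]
  refine sum_congr rfl fun U _ => ?_
  rw [coeff_C_mul_X_pow]
  by_cases h2 : x₂ = (U ∩ H₂).card
  · rw [if_pos h2, coeff_X_pow]
    by_cases h1 : x₁ = (U ∩ H₁).card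
    · rw [if_pos h1, if_pos ⟨h1.symm, h2.symm⟩]; simp
    · rw [if_neg h1, if_neg (fun h => h1 h.1.symm)]; simp
  · rw [if_neg h2, coeff_zero, if_neg (fun h => h2 h.2.symm)]; simp

end Weighted

end ShellStep

end Literature.Combinatorics.Optimization

end
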